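import Mathlib
import Literature.Probability.LatticeModels.MedialWinding
import Literature.Probability.LatticeModels.DartPhase
import Literature.Probability.RandomPlanarGeometry.PlanarDomains
import Literature.Probability.Percolation.Percolation

/-!
# Sketch — first lemmas of the three crux-idea cards for `CardySusyWard.ParafermionPrecompact`
(stmt-CriticalPhenomena-11293; crux-ideate round 1, ideator 2).

All three `def … : Prop` elaborate against the light, fact-free imports above; none is claimed
proved here (the cards say which are provable now).
-/

noncomputable section

open Literature.Probability.LatticeModels Literature.Probability.Percolation MeasureTheory

namespace Summit.CriticalPhenomena.CardyFormulaZ2.Cruxes.ParafermionPrecompact.Ideas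

/-! ## Card `kenyon-stream-second-relation` — the missing CR half is Kenyon-holomorphy of the
DST stream function; with it every class component of the edge observable is lattice harmonic. -/

/-- The `ℤ₄` character on the four corner classes `f - v ∈ {0, -e₀, -e₀-e₁, -e₁}` (the potential
weights `u` of the stream function `u(f-v)·E(v,f) = ψ(v) - ψ(f)`; values `(1, i, -1, -i)` as
certified for the tree's observable by triage T2 of crux EdgePrecompact). -/
def classPhase (c : Site 2) : ℂ :=
  if c = 0 then 1
  else if c = -(Pi.single 0 1) then Complex.I
  else if c = -(Pi.single 0 1) - Pi.single 1 1 then -1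
  else -Complex.I

/-- Potential (stream-function) form of the vertex half of Cauchy–Riemann on the whole plane:
`u(f - v) · E(v,f) = ψV v - ψF f` for every corner `(v,f)`. -/
def HasStreamFunction (E : Site 2 → Site 2 → ℂ) : Prop :=
  ∃ ψV ψF : Site 2 → ℂ, ∀ v f : Site 2, IsCorner v f → classPhase (f - v) * E v f = ψV v - ψF f

/-- The alternating ("sum", `F(A)+F(C) = F(B)+F(D)`) relation at the medial vertex of the lattice
edge `{x, x + eᵢ}`, the four corners listed cyclically: horizontal edge (`i = 0`, faces `x` above
and `x - e₁` below), vertical edge (`i = 1`, faces `x - e₀` west and `x` east). -/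
def SumRelationAt (E : Site 2 → Site 2 → ℂ) (x : Site 2) (i : Fin 2) : Prop :=
  if i = 0 then
    E x x - E (x + Pi.single 0 1) x + E (x + Pi.single 0 1) (x - Pi.single 1 1)
      - E x (x - Pi.single 1 1) = 0
  else
    E x x - E (x + Pi.single 1 1) x + E (x + Pi.single 1 1) (x - Pi.single 0 1)
      - E x (x - Pi.single 0 1) = 0

/-- Lattice harmonicity on all of `ℤ²` (the discrete mean-value property; agrees with the tree's
`IsLatticeHarmonicOn h Set.univ` of `LatticeLaplacian.lean`, not imported here to keep the cone
fact-free). -/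
def IsDiscreteHarmonic (h : Site 2 → ℂ) : Prop :=
  ∀ x : Site 2, h (x + Pi.single 0 1) + h (x - Pi.single 0 1) + h (x + Pi.single 1 1) +
    h (x - Pi.single 1 1) = 4 * h x

/-- FIRST LEMMA of card `kenyon-stream-second-relation` (pure algebra, provable now): stream
function (= vertex relation) + sum relation at every medial vertex ⇒ the stream function is
Kenyon-discrete-holomorphic (`ψ(v₂) - ψ(v₁) = i (ψ(f₂) - ψ(f₁))` on every quad) ⇒ `ψV`, `ψF`
lattice harmonic ⇒ every class component `x ↦ E(x, x + c)` is lattice harmonic. -/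
def ClassHarmonicOfBothRelations : Prop :=
  ∀ E : Site 2 → Site 2 → ℂ, HasStreamFunction E → (∀ x i, SumRelationAt E x i) →
    ∀ c : Site 2, c ∈ ({0, -(Pi.single 0 1), -(Pi.single 1 1), -(Pi.single 0 1) - Pi.single 1 1} :
        Set (Site 2)) →
      IsDiscreteHarmonic (fun x => E x (x + c))

/-! ## Card `triple-cover-sheet-mixing` — the first target strictly between the trivial bound
`‖F_δ(z)‖ ≤ P(z ∈ γ)` and the crux: a polynomial gain from equidistribution of the cover sheet. -/

/-- FIRST LEMMA / first target of card `triple-cover-sheet-mixing` (family form, edge-guarded):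
there is `c > 0` such that for every Dobrushin domain, admissible family and compact `K`, the
spin-`1/3` vertex observable is eventually bounded by `C · δ^c ·` (passage probability) on `K`
— sheet mixing across the `≍ log(1/δ)` annuli around `z`. -/
def SubPassageTwistBound : Prop :=
  ∃ c : ℝ, 0 < c ∧ ∀ (D : Literature.Probability.RandomPlanarGeometry.DobrushinDomain)
    (Λ : ℝ → DiscreteDobrushin), (∀ δ, (Λ δ).Ω = D.carrier) → (∀ δ, (Λ δ).δ = δ) →
    (∀ᶠ δ in nhdsWithin (0:ℝ) (Set.Ioi 0), (Λ δ).IsZdAdmissible) →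
    ∀ K : Set ℂ, IsCompact K → K ⊆ D.carrier → ∃ C : ℝ, ∀ᶠ δ in nhdsWithin (0:ℝ) (Set.Ioi 0),
      ∀ z : MedialVertex, z ∈ (zdGraph 2).edgeSet → medialPoint δ z ∈ K →
        ‖(∫ ω, MedialPath.passageSum (medialExploration (Λ δ) ω) δ (1 / 3) z
            ∂(bondPercolation (zdGraph 2) half))‖ ≤
          C * δ ^ c * (bondPercolation (zdGraph 2) half).real {ω | z ∈ medialExploration (Λ δ) ω}

/-! ## Card `cube-primitive-pinning` — Smirnov's `H` at `q = 1` is `Im ∫ F³ dz`: on the free arc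
its increments have a deterministic argument (the winding phase to the power `1/σ = 3` cancels the
rotation of `dz` exactly). -/

/-- A dart `c = (v, f)` runs ALONG the free (`B`) arc of the discretisation `E`: `f` is an inner
face of `E` having a full side on the discrete arc `B`, and the pivot `v` is not a `B`-site. -/
def IsFreeArcDart (E : DiscreteDobrushin) (c : Site 2 × Site 2) : Prop :=
  IsCorner c.1 c.2 ∧ E.IsInnerFace c.2 ∧ c.1 ∉ E.zdArcB ∧
    ∃ y y' : Site 2, y ∈ E.zdArcB ∧ y' ∈ E.zdArcB ∧ (zdGraph 2).Adj y y' ∧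
      IsCorner y c.2 ∧ IsCorner y' c.2

/-- FIRST LEMMA of card `cube-primitive-pinning` (Umlaufsatz bookkeeping, the `q = 1` twin of the
tree's `FreeArcPhase.turnCount_eq_zero_or_eight`): along the free arc the phase of the spin-`1/3`
dart observable is deterministic, and its CUBE times the dart vector `dz` has one and the same
argument `θ` for ALL free-arc darts of an admissible datum — so `Im (e^{-iθ} Σ F³ dz)` is
constant along the free arc, whatever the shape of the domain. -/
def CubeIncrementPinnedOnFreeArc : Prop :=
  ∀ (E : DiscreteDobrushin), E.IsZdAdmissible → 0 < E.δ → ∃ θ : ℝ, ∀ c : Site 2 × Site 2,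
    IsFreeArcDart E c → ∃ r : ℝ, 0 ≤ r ∧
      (bondDartObservable E E.δ (1 / 3) c) ^ 3 *
          (medialPoint E.δ (cornerTarget c.1 c.2) - medialPoint E.δ (cornerSource c.1 c.2)) =
        r * Complex.exp (Complex.I * θ)

end Summit.CriticalPhenomena.CardyFormulaZ2.Cruxes.ParafermionPrecompact.Ideas

end
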